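import Summits.SmoothPoincare4.SmoothPoincare4.Theses.EntropyRung

/-!
# Sketch (crux-ideate, ideator 2) — crux `EntropyRung.ConicalGap` (stmt-SmoothPoincare4-16589)

Card `avr-window`.  Typed first lemmas:

* `DensityDominatesAVR` — Wang–Wang 2023 (arXiv:2308.06560, CVPDE 64 (2025)) Thm 1.1 in dimension 4,
  spelled over the crux vocabulary: for a complete normalised gradient shrinker, every ball-volume
  ratio is eventually below the Gaussian density, `Vol B(x,r) ≤ ((16π²)⁻¹ ∫ e^{-f} dV + ε) ω₄ r⁴`
  for `r ≥ r₀(x, ε)`, i.e. `AVR ≤ Θ`.  (To be vendored as a Literature named fact.)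
* `ThinCone` — the NECESSARY CONDITION the crux imposes on the asymptotic cone of an
  asymptotically conical shrinker: `AVR ≤ Θ(S³×ℝ) = 2√π e^{-3/2}`, i.e. the link `(N,h)` of a
  shrinker-fillable cone has `Vol(N,h) ≤ 2π² · 0.791`.
* `thinCone_of_conicalGap` — PROVED: `DensityDominatesAVR → ConicalGap → ThinCone`.
-/

noncomputable section

open scoped Manifold ContDiff Topology ENNReal NNReal
open MeasureTheory Set Filter

namespace Summit.SmoothPoincare4.SmoothPoincare4.Cruxes.ConicalGap.SketchIdeator2

/-- `(4π)² · Θ(S³×ℝ) = 32 π² √π e^{-3/2} ≈ 124.9`, the constant of the crux. -/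
def cylMass : ℝ := 32 * Real.pi ^ 2 * Real.sqrt Real.pi * Real.exp (-(3 : ℝ) / 2)

/-- `Θ(S³×ℝ) = 2 √π e^{-3/2} ≈ 0.791`. -/
def thetaCyl : ℝ := 2 * Real.sqrt Real.pi * Real.exp (-(3 : ℝ) / 2)

/-- `ω₄ = π²/2`, the volume of the unit Euclidean 4-ball. -/
def omega4 : ℝ := Real.pi ^ 2 / 2

lemma cylMass_eq : (16 * Real.pi ^ 2)⁻¹ * cylMass = thetaCyl := by
  unfold cylMass thetaCyl
  have hπ : Real.pi ≠ 0 := Real.pi_ne_zero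
  field_simp
  ring

lemma thetaCyl_nonneg : 0 ≤ thetaCyl := by
  unfold thetaCyl; positivity

lemma omega4_nonneg : 0 ≤ omega4 := by
  unfold omega4; positivity

/-- WANG–WANG 2023 Thm 1.1 (`AVR ≤ e^μ = Θ`), dimension 4, over the crux vocabulary (complete
normalised gradient shrinker; no curvature or non-flatness hypothesis).  Junk-free in `ℝ≥0∞`:
if `∫⁻ e^{-f} = ∞` the bound is vacuous (it is finite by Cao–Zhou). -/
def DensityDominatesAVR : Prop :=
  ∀ (M : Type) [TopologicalSpace M] [T2Space M] [SecondCountableTopology M]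
    [ChartedSpace (EuclideanSpace ℝ (Fin 4)) M] [IsManifold (𝓡 4) ∞ M] [ConnectedSpace M]
    [NoncompactSpace M] [T3Space M] [MeasurableSpace M] [BorelSpace M]
    (g : Literature.Geometry.Lorentzian.PseudoRiemannianMetric (𝓡 4) ∞ (EuclideanSpace ℝ (Fin 4))
      (TangentSpace (𝓡 4) : M → Type _)) [g.HasLeviCivita] (f : M → ℝ) (hg : g.IsRiemannian),
    (∀ (x : M) (r : NNReal), IsCompact {y : M | g.edist hg x y ≤ r}) →
    ContMDiff (𝓡 4) 𝓘(ℝ, ℝ) ∞ f →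
    (∀ (x : M) (X Y : TangentSpace (𝓡 4) x),
      g.ricci x X Y + g.hessian f x X Y = (1 / 2 : ℝ) * g.val x X Y) →
    (∀ x : M, g.scalarCurvature x + g.gradSq f x = f x) →
    ∀ (x : M) (ε : ℝ), 0 < ε → ∃ r₀ : NNReal, ∀ r : NNReal, r₀ ≤ r →
      Literature.Geometry.Lorentzian.riemannianMeasure (g.toContMDiffRiemannianMetric hg)
          {y : M | g.edist hg x y ≤ r} ≤
        (ENNReal.ofReal ((16 * Real.pi ^ 2)⁻¹) *
            (∫⁻ y, ENNReal.ofReal (Real.exp (-f y))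
              ∂(Literature.Geometry.Lorentzian.riemannianMeasure (g.toContMDiffRiemannianMetric hg)))
          + ENNReal.ofReal ε) * ENNReal.ofReal (omega4 * (r : ℝ) ^ 4)

/-- THIN-CONE: the asymptotic volume ratio of a complete non-compact non-flat normalised 4-d
gradient shrinker with `R → 0` at infinity (the asymptotically conical class of the crux) is at most
`Θ(S³×ℝ)`: eventually `Vol B(x,r) ≤ (2√π e^{-3/2} + ε) ω₄ r⁴`.  Equivalently the link `(N,h)` of
the asymptotic cone has `Vol(N,h) ≤ 2π²·Θ(S³×ℝ) ≈ 15.6`. -/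
def ThinCone : Prop :=
  ∀ (M : Type) [TopologicalSpace M] [T2Space M] [SecondCountableTopology M]
    [ChartedSpace (EuclideanSpace ℝ (Fin 4)) M] [IsManifold (𝓡 4) ∞ M] [ConnectedSpace M]
    [NoncompactSpace M] [T3Space M] [MeasurableSpace M] [BorelSpace M]
    (g : Literature.Geometry.Lorentzian.PseudoRiemannianMetric (𝓡 4) ∞ (EuclideanSpace ℝ (Fin 4))
      (TangentSpace (𝓡 4) : M → Type _)) [g.HasLeviCivita] (f : M → ℝ) (hg : g.IsRiemannian),
    (∀ (x : M) (r : NNReal), IsCompact {y : M | g.edist hg x y ≤ r}) →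
    ContMDiff (𝓡 4) 𝓘(ℝ, ℝ) ∞ f →
    (∀ (x : M) (X Y : TangentSpace (𝓡 4) x),
      g.ricci x X Y + g.hessian f x X Y = (1 / 2 : ℝ) * g.val x X Y) →
    (∀ x : M, g.scalarCurvature x + g.gradSq f x = f x) →
    (∃ x : M, g.scalarCurvature x ≠ 0) →
    (∀ ε : ℝ, 0 < ε → ∃ K : Set M, IsCompact K ∧ ∀ x, x ∉ K → g.scalarCurvature x < ε) →
    ∀ (x : M) (ε : ℝ), 0 < ε → ∃ r₀ : NNReal, ∀ r : NNReal, r₀ ≤ r →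
      Literature.Geometry.Lorentzian.riemannianMeasure (g.toContMDiffRiemannianMetric hg)
          {y : M | g.edist hg x y ≤ r} ≤
        ENNReal.ofReal ((thetaCyl + ε) * (omega4 * (r : ℝ) ^ 4))

/-- The crux implies THIN-CONE, given Wang–Wang's `AVR ≤ Θ` (pure bookkeeping). -/
theorem thinCone_of_conicalGap (hW : DensityDominatesAVR)
    (hC : Summit.SmoothPoincare4.SmoothPoincare4.Theses.EntropyRung.ConicalGap) : ThinCone := by
  intro M _ _ _ _ _ _ _ _ _ _ g _ f hg hcpl hf hsol hnorm hnf hdec x ε hε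
  obtain ⟨r₀, hr₀⟩ := hW M g f hg hcpl hf hsol hnorm x ε hε
  have hZ := hC M g f hg hcpl hf hsol hnorm hnf hdec
  refine ⟨r₀, fun r hr => ?_⟩
  have h1 := hr₀ r hr
  refine h1.trans ?_
  have hV : 0 ≤ omega4 * (r : ℝ) ^ 4 := mul_nonneg omega4_nonneg (by positivity)
  have hc : 0 ≤ (16 * Real.pi ^ 2)⁻¹ := by positivity
  calc (ENNReal.ofReal ((16 * Real.pi ^ 2)⁻¹) *
            (∫⁻ y, ENNReal.ofReal (Real.exp (-f y))
              ∂(Literature.Geometry.Lorentzian.riemannianMeasure (g.toContMDiffRiemannianMetric hg)))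
          + ENNReal.ofReal ε) * ENNReal.ofReal (omega4 * (r : ℝ) ^ 4)
        ≤ (ENNReal.ofReal ((16 * Real.pi ^ 2)⁻¹) * ENNReal.ofReal cylMass + ENNReal.ofReal ε)
            * ENNReal.ofReal (omega4 * (r : ℝ) ^ 4) := by
          gcongr
          exact hZ
    _ = ENNReal.ofReal ((thetaCyl + ε) * (omega4 * (r : ℝ) ^ 4)) := by
          rw [← ENNReal.ofReal_mul hc, cylMass_eq, ← ENNReal.ofReal_add thetaCyl_nonneg hε.le,
            ← ENNReal.ofReal_mul (add_nonneg thetaCyl_nonneg hε.le)]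

end Summit.SmoothPoincare4.SmoothPoincare4.Cruxes.ConicalGap.SketchIdeator2
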